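import Summits.BirchSwinnertonDyer.Rank1Residual.X6.RankZeroCertificateDisplay
import Summits.BirchSwinnertonDyer.Rank1Residual.Supersingular.X6RankZeroErratumDefs
import Mathlib.Algebra.QuadraticDiscriminant
import HarnessLib

/-!
# Class X6 ∧ analytic rank `0` — the ERRATUM-PRIME certificate of every record: `HasErratumPrime W p`
# decided IN THE KERNEL for the 734 pairs of the display (road (E) / EDIT #4 split `Err` ∣ `Rest`)

Cell `bsd-print-x6` (D-0131 (2) print tier, key `x6`; HOME `run/shared/lean/pub/bsd-print-x6/`), typer seat ty3.
Companion of `RankZeroCertificateKernel.lean` (what a record PROVES about its curve) and of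
`Supersingular/X6RankZeroErratumDefs.lean` (seat ty2: the sub-class predicate
`HasErratumPrime W p := ∃ q prime, mult(q) ∧ NONSPLIT(q) ∧ p ∤ ord_q(Δ_min)` along which the planner's EDIT #4
splits crux `EisensteinHalfFiveLe` into `…Err` / `…Rest`, PLAN.md v3.2). PARTITION (D-0054): leaf X6 ∧ r = 0 (K3 row
A6) — types-the-object-of; closes NONE. HONEST FRAMING: nothing here asserts BSD or any `L`-value; every theorem is
about the decidable shadow of a record that passed `Record.check`, now INCLUDING the reduction TYPE (split / non-split)
at each bad prime, which the recheck of `RankZeroCertificateSchema.lean` computes (`splitAt`, Tate's algorithm at a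
multiplicative prime of a minimal model) but which `RankZeroCertificateKernel.lean` did not yet connect to the tree's
`WeierstrassCurve.HasSplitMultiplicativeReductionAtPrime`.

* §1 (generic, any integer model `E₀`, any prime `q ∣ Δ(E₀)`, `q ∤ c₄(E₀)`): the node-tangent quadratic
  `c₄T² + a₁c₄T − (54b₆ − 3b₂b₄ + a₂c₄)` of the tree's split criterion
  (`IntModel.hasSplitMultiplicativeReductionAtPrime_iff_splits`, Silverman VII.5.1(b)) has discriminant `−c₄c₆`
  (`discrim_nodal`), and `c₄³ ≡ c₆²`, `c₄ ≢ 0 (mod q)`; so for ODD `q` it has a root iff `−c₆` is a square mod `q`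
  (`nodal_root_of_isSquare`, `nodal_noroot_of_not_isSquare`), and for `q = 2` (then `a₁` odd) iff `a₂ + a₃` is even
  (`nodal_two_root`, `nodal_two_noroot`). This is exactly the recheck's `splitAt` rule.
* §2 (record level): Bool certificates `nonsplitCert` (odd `q`: Euler's criterion value `q − 1`, i.e. `isQNR (−c₆) q`;
  `q = 2`: `a₁` odd and `a₂ + a₃` odd) next to the schema's `splitAt`; `Record.errAt` (:= some listed bad `(q, v)` with
  `nonsplitCert q ∧ p ∤ v`) and `Record.restAt` (:= every listed bad `(q, v)` has `splitAt q ∨ p ∣ v`); KERNEL THEOREMS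
  `Record.not_split_of_mem_bad` / `Record.split_of_mem_bad` (the reduction type at a listed prime),
  **`Record.hasErratumPrime_of_check`** (`errAt ⇒ HasErratumPrime W p`) and **`Record.not_hasErratumPrime_of_check`**
  (`restAt ⇒ ¬ HasErratumPrime W p`, using `Record.mem_badPrimes_of_not_good`: an erratum prime is a listed one).
* The DATA (the Err ∣ Rest partition of the 734 records by `decide +kernel`: 107 / 6 at `p ≥ 5`, 544 / 77 at `p = 3`,
  two engines) and the DISPLAY (`HasErratumPrime W p ↔ errAt` per listed pair; both EDIT-#4 children inhabited at
  explicit cells `22678e1 @ 5` / `138594b1 @ 5`) are in the sibling `RankZeroCertificateErratumDisplay.lean`.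

References: J. H. Silverman, *AEC* (2009) VII.5 Prop. 5.1(b), App. C §15 (Tate's algorithm, type `I_n`)
[SilvermanAEC2009]; K. Ireland, M. Rosen, Prop. 5.1.2 (Euler's criterion) [IrelandRosen1990]; F. Castella, X. Wan,
§2 (gen-H) and proof of Thm. 6.11 (the shape of the erratum prime; nothing of it asserted) [CastellaWan2023];
C. Skinner, E. Urban, Thm. 2 (ram) [SkinnerUrban2014]; J. E. Cremona, the elliptic curve database [Cremona2006].
-/

set_option autoImplicit false

open WeierstrassCurve Literature.NumberTheory.EllipticCurves
  Literature.NumberTheory.EllipticCurves.Rank1Residual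
  Literature.NumberTheory.EllipticCurves.Rank1Residual.X11RankOneCertificates
  Summit.BirchSwinnertonDyer.BirchSwinnertonDyer.Rank1Residual.IntModel
  Summit.BirchSwinnertonDyer.BirchSwinnertonDyer.Rank1Residual.X11RankOne
  Summit.BirchSwinnertonDyer.Rank1Residual.Supersingular

namespace Summit.BirchSwinnertonDyer.Rank1Residual.X6.PrintCert

/-! ### §1 The node-tangent quadratic of an integer model at a multiplicative prime: root criteria -/

section Nodal

variable (E₀ : WeierstrassCurve ℤ)

/-- `a₁²c₄ + 4(54b₆ − 3b₂b₄ + a₂c₄) = −c₆` (so the node-tangent quadratic `c₄T² + a₁c₄T − (54b₆ − 3b₂b₄ + a₂c₄)`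
has discriminant `−c₄c₆`). [cite: SilvermanAEC2009, III.1 (b₂, b₄, b₆, c₄, c₆)] -/
theorem nodal_constant_identity :
    E₀.a₁ ^ 2 * E₀.c₄ + 4 * (54 * E₀.b₆ - 3 * E₀.b₂ * E₀.b₄ + E₀.a₂ * E₀.c₄) = -E₀.c₆ := by
  simp only [WeierstrassCurve.b₂, WeierstrassCurve.b₄, WeierstrassCurve.b₆, WeierstrassCurve.c₄,
    WeierstrassCurve.c₆]
  ring

/-- The discriminant of the node-tangent quadratic, in any commutative ring receiving `ℤ`, is `−c₄c₆`. [folklore] -/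
theorem discrim_nodal {R : Type*} [CommRing R] :
    discrim (E₀.c₄ : R) (E₀.a₁ * E₀.c₄ : R) (-(54 * E₀.b₆ - 3 * E₀.b₂ * E₀.b₄ + E₀.a₂ * E₀.c₄ : R)) =
      -((E₀.c₄ : R) * E₀.c₆) := by
  have h := congrArg (Int.cast : ℤ → R) (nodal_constant_identity E₀)
  push_cast at h
  rw [discrim]
  linear_combination (E₀.c₄ : R) * h

variable (q : ℕ) [hq : Fact q.Prime]

/-- At a prime `q ∣ Δ(E₀)`: `c₄³ = c₆²` in `𝔽_q` (`1728Δ = c₄³ − c₆²`). [cite: SilvermanAEC2009, III.1] -/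
theorem c₄_pow_three_eq_c₆_sq_of_dvd (hΔ : (q : ℤ) ∣ E₀.Δ) :
    (E₀.c₄ : ZMod q) ^ 3 = (E₀.c₆ : ZMod q) ^ 2 := by
  have h := congrArg (Int.cast : ℤ → ZMod q) E₀.c_relation
  push_cast at h
  have h0 : (E₀.Δ : ZMod q) = 0 := (ZMod.intCast_zmod_eq_zero_iff_dvd _ _).mpr hΔ
  rw [h0, mul_zero] at h
  linear_combination -1 * h

/-- At a prime `q ∤ c₄(E₀)`: `c₄ ≠ 0` in `𝔽_q`. [folklore] -/
theorem c₄_cast_ne_zero (hc₄ : ¬ (q : ℤ) ∣ E₀.c₄) : (E₀.c₄ : ZMod q) ≠ 0 := by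
  rw [Ne, ZMod.intCast_zmod_eq_zero_iff_dvd]; exact hc₄

/-- At a multiplicative prime (`q ∣ Δ`, `q ∤ c₄`): `c₆ ≠ 0` in `𝔽_q`. [folklore] -/
theorem c₆_cast_ne_zero (hΔ : (q : ℤ) ∣ E₀.Δ) (hc₄ : ¬ (q : ℤ) ∣ E₀.c₄) : (E₀.c₆ : ZMod q) ≠ 0 := by
  intro h0
  have h3 := c₄_pow_three_eq_c₆_sq_of_dvd E₀ q hΔ
  rw [h0, zero_pow two_ne_zero] at h3
  exact c₄_cast_ne_zero E₀ q hc₄ (pow_eq_zero_iff (three_ne_zero) |>.mp h3)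

/-- At a multiplicative prime: `−c₆` is a square in `𝔽_q` iff the nodal discriminant `−c₄c₆` is
(`c₄ = (c₆/c₄)²` is itself a square). [folklore] -/
theorem isSquare_neg_c₆_iff (hΔ : (q : ℤ) ∣ E₀.Δ) (hc₄ : ¬ (q : ℤ) ∣ E₀.c₄) :
    IsSquare (-(E₀.c₆ : ZMod q)) ↔ IsSquare (-((E₀.c₄ : ZMod q) * E₀.c₆)) := by
  have h3 := c₄_pow_three_eq_c₆_sq_of_dvd E₀ q hΔ
  have h4 := c₄_cast_ne_zero E₀ q hc₄
  have h6 := c₆_cast_ne_zero E₀ q hΔ hc₄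
  constructor
  · rintro ⟨r, hr⟩
    have hu : (E₀.c₄ : ZMod q) * (E₀.c₄ : ZMod q)⁻¹ = 1 := mul_inv_cancel₀ h4
    refine ⟨r * E₀.c₆ * (E₀.c₄ : ZMod q)⁻¹, ?_⟩
    linear_combination ((E₀.c₆ : ZMod q) ^ 2 * (E₀.c₄ : ZMod q)⁻¹ ^ 2) * hr
      - ((E₀.c₆ : ZMod q) * (E₀.c₄ : ZMod q)⁻¹ ^ 2) * h3
      + ((E₀.c₄ : ZMod q) * E₀.c₆ * ((E₀.c₄ : ZMod q) * (E₀.c₄ : ZMod q)⁻¹ + 1)) * hu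
  · rintro ⟨s, hs⟩
    have hw : (E₀.c₆ : ZMod q) * (E₀.c₆ : ZMod q)⁻¹ = 1 := mul_inv_cancel₀ h6
    refine ⟨s * E₀.c₄ * (E₀.c₆ : ZMod q)⁻¹, ?_⟩
    linear_combination ((E₀.c₄ : ZMod q) ^ 2 * (E₀.c₆ : ZMod q)⁻¹ ^ 2) * hs
      + ((E₀.c₆ : ZMod q) * (E₀.c₆ : ZMod q)⁻¹ ^ 2) * h3
      + ((E₀.c₆ : ZMod q) * ((E₀.c₆ : ZMod q) * (E₀.c₆ : ZMod q)⁻¹ + 1)) * hw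

/-- `2 ≠ 0` in `𝔽_q` for an odd prime `q`. [folklore] -/
theorem two_ne_zero_zmod (hq2 : q ≠ 2) : (2 : ZMod q) ≠ 0 := by
  intro h2
  have : (q : ℤ) ∣ 2 := (ZMod.intCast_zmod_eq_zero_iff_dvd 2 q).mp (by exact_mod_cast h2)
  have hq2' : q ∣ 2 := by exact_mod_cast this
  rcases Nat.prime_two.eq_one_or_self_of_dvd q hq2' with h | h
  · exact hq.out.one_lt.ne' h
  · exact hq2 h

/-- **Split certificate, odd `q`**: at a multiplicative prime `q ≠ 2` with `−c₆` a square mod `q`, the node-tangent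
quadratic has a root in `𝔽_q`. [cite: SilvermanAEC2009, VII.5 Prop. 5.1(b)] -/
theorem nodal_root_of_isSquare (hq2 : q ≠ 2) (hΔ : (q : ℤ) ∣ E₀.Δ) (hc₄ : ¬ (q : ℤ) ∣ E₀.c₄)
    (hsq : IsSquare (-(E₀.c₆ : ZMod q))) :
    ∃ t : ZMod q, (E₀.c₄ : ZMod q) * t ^ 2 + (E₀.a₁ * E₀.c₄ : ZMod q) * t
      - (54 * E₀.b₆ - 3 * E₀.b₂ * E₀.b₄ + E₀.a₂ * E₀.c₄ : ZMod q) = 0 := by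
  haveI : NeZero (2 : ZMod q) := ⟨two_ne_zero_zmod q hq2⟩
  obtain ⟨s, hs⟩ := (isSquare_neg_c₆_iff E₀ q hΔ hc₄).mp hsq
  obtain ⟨x, hx⟩ := exists_quadratic_eq_zero (c₄_cast_ne_zero E₀ q hc₄)
    ⟨s, (discrim_nodal E₀ (R := ZMod q)).trans hs⟩
  exact ⟨x, by linear_combination hx⟩

/-- **Non-split certificate, odd `q`**: at a multiplicative prime `q ≠ 2` with `−c₆` a NON-square mod `q`, the
node-tangent quadratic has no root in `𝔽_q`. [cite: SilvermanAEC2009, VII.5 Prop. 5.1(b)] -/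
theorem nodal_noroot_of_not_isSquare (hΔ : (q : ℤ) ∣ E₀.Δ) (hc₄ : ¬ (q : ℤ) ∣ E₀.c₄)
    (hns : ¬ IsSquare (-(E₀.c₆ : ZMod q))) :
    ∀ t : ZMod q, (E₀.c₄ : ZMod q) * t ^ 2 + (E₀.a₁ * E₀.c₄ : ZMod q) * t
      - (54 * E₀.b₆ - 3 * E₀.b₂ * E₀.b₄ + E₀.a₂ * E₀.c₄ : ZMod q) ≠ 0 := by
  intro t ht
  have hne : ∀ s : ZMod q, discrim (E₀.c₄ : ZMod q) (E₀.a₁ * E₀.c₄ : ZMod q)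
      (-(54 * E₀.b₆ - 3 * E₀.b₂ * E₀.b₄ + E₀.a₂ * E₀.c₄ : ZMod q)) ≠ s ^ 2 := by
    intro s hs
    rw [discrim_nodal E₀ (R := ZMod q)] at hs
    exact hns ((isSquare_neg_c₆_iff E₀ q hΔ hc₄).mpr ⟨s, by rw [hs, sq]⟩)
  exact quadratic_ne_zero_of_discrim_ne_sq hne t (by linear_combination ht)

/-- **Split certificate at `2`**: `a₁` odd and `a₂ + a₃` even (then `c₄` is odd and the node-tangent quadratic mod `2`
is `T² + T`, root `T = 0`). [cite: SilvermanAEC2009, VII.5 Prop. 5.1(b)] -/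
theorem nodal_two_root (h1 : (E₀.a₁ : ZMod 2) = 1) (h23 : (E₀.a₂ : ZMod 2) + E₀.a₃ = 0) :
    ∃ t : ZMod 2, (E₀.c₄ : ZMod 2) * t ^ 2 + (E₀.a₁ * E₀.c₄ : ZMod 2) * t
      - (54 * E₀.b₆ - 3 * E₀.b₂ * E₀.b₄ + E₀.a₂ * E₀.c₄ : ZMod 2) = 0 := by
  simp only [WeierstrassCurve.b₂, WeierstrassCurve.b₄, WeierstrassCurve.b₆, WeierstrassCurve.c₄]
  push_cast
  revert h1 h23
  generalize (E₀.a₁ : ZMod 2) = x1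
  generalize (E₀.a₂ : ZMod 2) = x2
  generalize (E₀.a₃ : ZMod 2) = x3
  generalize (E₀.a₄ : ZMod 2) = x4
  generalize (E₀.a₆ : ZMod 2) = x6
  revert x1 x2 x3 x4 x6
  decide

/-- **Non-split certificate at `2`**: `a₁` odd and `a₂ + a₃` odd (the node-tangent quadratic mod `2` is `T² + T + 1`,
no root in `𝔽₂`). [cite: SilvermanAEC2009, VII.5 Prop. 5.1(b)] -/
theorem nodal_two_noroot (h1 : (E₀.a₁ : ZMod 2) = 1) (h23 : (E₀.a₂ : ZMod 2) + E₀.a₃ = 1) :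
    ∀ t : ZMod 2, (E₀.c₄ : ZMod 2) * t ^ 2 + (E₀.a₁ * E₀.c₄ : ZMod 2) * t
      - (54 * E₀.b₆ - 3 * E₀.b₂ * E₀.b₄ + E₀.a₂ * E₀.c₄ : ZMod 2) ≠ 0 := by
  simp only [WeierstrassCurve.b₂, WeierstrassCurve.b₄, WeierstrassCurve.b₆, WeierstrassCurve.c₄]
  push_cast
  revert h1 h23
  generalize (E₀.a₁ : ZMod 2) = x1
  generalize (E₀.a₂ : ZMod 2) = x2
  generalize (E₀.a₃ : ZMod 2) = x3
  generalize (E₀.a₄ : ZMod 2) = x4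
  generalize (E₀.a₆ : ZMod 2) = x6
  revert x1 x2 x3 x4 x6
  decide

end Nodal

/-- `c₆` of the integer curve is the recheck's `c6Of`. [cite: SilvermanAEC2009, III.1] -/
theorem intCurve_c₆ (a1 a2 a3 a4 a6 : ℤ) :
    (⟨a1, a2, a3, a4, a6⟩ : WeierstrassCurve ℤ).c₆ = c6Of [a1, a2, a3, a4, a6] := by
  simp only [WeierstrassCurve.c₆, WeierstrassCurve.b₂, WeierstrassCurve.b₄, WeierstrassCurve.b₆, c6Of, invariants]
  ring

/-- An odd integer is `1` in `ZMod 2` (the even case is `Tunnell1983.HeckeXi.intCast_zmod_two_eq_zero`, inlined below). [folklore] -/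
theorem intCast_zmod_two_eq_one_of_mod_ne {a : ℤ} (h : a % 2 ≠ 0) : (a : ZMod 2) = 1 := by
  rw [← ZMod.intCast_mod a 2]
  rcases Int.emod_two_eq_zero_or_one a with h0 | h1
  · exact absurd h0 h
  · rw [show (a % ((2 : ℕ) : ℤ)) = 1 from h1]; rfl

/-! ### §2 Record level: the Bool certificates and what they prove -/

/-- NON-SPLIT certificate for a minimal integral model `[a₁,…,a₆]` at a multiplicative prime `q`: for odd `q`,
Euler's criterion finds `−c₆` a non-residue (`isQNR`); for `q = 2` (then `a₁` is odd), `a₂ + a₃` is odd. The negation of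
the recheck's `splitAt` on the cell's data, stated positively so that `true` certifies. [cite: SilvermanAEC2009, VII.5 Prop. 5.1(b) and C.15] -/
def nonsplitCert (a : List ℤ) (q : ℕ) : Bool :=
  if q = 2 then
    match a with
    | [a1, a2, a3, _, _] => decide (a1 % 2 ≠ 0 ∧ (a2 + a3) % 2 ≠ 0)
    | _ => false
  else isQNR (-(c6Of a)) q

namespace Record

variable (r : Record)

/-- **Err certificate** of a record: some listed bad `(q, v_q(Δ))` is certified NON-SPLIT with `p ∤ v_q(Δ)` — the
shape of `hasErratumPrime_of_mult_of_not_split`. [folklore] -/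
def errAt : Bool := r.bad.any fun t => nonsplitCert r.ainvs t.1 && decide (¬ r.p ∣ t.2)

/-- **Rest certificate** of a record: every listed bad `(q, v_q(Δ))` is certified SPLIT (`splitAt`) or has `p ∣ v_q(Δ)`.
[folklore] -/
def restAt : Bool := r.bad.all fun t => splitAt r.ainvs t.1 || decide (r.p ∣ t.2)

/-- A listed pair `(q, v)` of a certified record whose `q` carries the non-split certificate: `E` does NOT have split
multiplicative reduction at `q` (so, with `mult_and_val_of_mem_bad`, non-split multiplicative, `a_q = −1`).
[cite: SilvermanAEC2009, VII.5 Prop. 5.1(b)] -/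
theorem not_split_of_mem_bad (hc : r.check = true) [r.curve.IsElliptic] [r.curve.IsGloballyMinimal]
    {q v : ℕ} (ht : (q, v) ∈ r.bad) (hn : nonsplitCert r.ainvs q = true) :
    haveI : Fact q.Prime := ⟨((r.support_data_of_check hc).1 (q, v) ht).1⟩
    ¬ r.curve.HasSplitMultiplicativeReductionAtPrime q := by
  obtain ⟨a1, a2, a3, a4, a6, hA⟩ := r.exists_ainvs_eq_of_check hc
  obtain ⟨hall, -, -⟩ := r.support_data_of_check hc
  obtain ⟨hq, hlt, hv, hc4, hdv, -⟩ := hall (q, v) ht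
  dsimp only at hq hlt hv hc4 hdv
  haveI : Fact q.Prime := ⟨hq⟩
  have hI := r.integralModelInt_eq_of_ainvs hA
  rw [hA] at hc4 hdv hn
  have hΔ : (q : ℤ) ∣ (⟨a1, a2, a3, a4, a6⟩ : WeierstrassCurve ℤ).Δ := by
    rw [intCurve_Δ]
    have h1 : (q : ℤ) ^ v ∣ discOf [a1, a2, a3, a4, a6] := by
      have := Int.natCast_dvd.mpr hdv; exact_mod_cast this
    exact (dvd_pow_self (q : ℤ) hv.ne').trans h1
  have hc₄ : ¬ (q : ℤ) ∣ (⟨a1, a2, a3, a4, a6⟩ : WeierstrassCurve ℤ).c₄ := by rw [intCurve_c₄]; exact hc4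
  refine not_hasSplitMultiplicativeReductionAtPrime_of_intModel_of_noroot hI q hΔ hc₄ ?_
  by_cases h2 : q = 2
  · -- `q = 2`: parity certificate
    subst h2
    simp only [nonsplitCert, ↓reduceIte, decide_eq_true_eq] at hn
    have h1 : (a1 : ZMod 2) = 1 := intCast_zmod_two_eq_one_of_mod_ne hn.1
    have h23 : (a2 : ZMod 2) + (a3 : ZMod 2) = 1 := by
      have := intCast_zmod_two_eq_one_of_mod_ne hn.2
      push_cast at this; exact this
    exact nodal_two_noroot (⟨a1, a2, a3, a4, a6⟩ : WeierstrassCurve ℤ) h1 h23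
  · -- odd `q`: Euler's criterion certificate
    simp only [nonsplitCert, h2, ↓reduceIte] at hn
    have hJ := jacobiSym_eq_neg_one_of_isQNR hq h2 (by omega) hn
    have hns : ¬ IsSquare (-(((⟨a1, a2, a3, a4, a6⟩ : WeierstrassCurve ℤ).c₆ : ℤ) : ZMod q)) := by
      rw [intCurve_c₆, ← Int.cast_neg]
      exact ZMod.nonsquare_of_jacobiSym_eq_neg_one hJ
    exact nodal_noroot_of_not_isSquare ⟨a1, a2, a3, a4, a6⟩ q hΔ hc₄ hns

/-- A listed pair `(q, v)` of a certified record whose `q` carries the split certificate `splitAt`: `E` HAS split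
multiplicative reduction at `q` (`a_q = +1`). [cite: SilvermanAEC2009, VII.5 Prop. 5.1(b)] -/
theorem split_of_mem_bad (hc : r.check = true) [r.curve.IsElliptic] [r.curve.IsGloballyMinimal]
    {q v : ℕ} (ht : (q, v) ∈ r.bad) (hs : splitAt r.ainvs q = true) :
    haveI : Fact q.Prime := ⟨((r.support_data_of_check hc).1 (q, v) ht).1⟩
    r.curve.HasSplitMultiplicativeReductionAtPrime q := by
  obtain ⟨a1, a2, a3, a4, a6, hA⟩ := r.exists_ainvs_eq_of_check hc
  obtain ⟨hall, -, -⟩ := r.support_data_of_check hc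
  obtain ⟨hq, hlt, hv, hc4, hdv, -⟩ := hall (q, v) ht
  dsimp only at hq hlt hv hc4 hdv
  haveI : Fact q.Prime := ⟨hq⟩
  have hI := r.integralModelInt_eq_of_ainvs hA
  rw [hA] at hc4 hdv hs
  have hΔ : (q : ℤ) ∣ (⟨a1, a2, a3, a4, a6⟩ : WeierstrassCurve ℤ).Δ := by
    rw [intCurve_Δ]
    have h1 : (q : ℤ) ^ v ∣ discOf [a1, a2, a3, a4, a6] := by
      have := Int.natCast_dvd.mpr hdv; exact_mod_cast this
    exact (dvd_pow_self (q : ℤ) hv.ne').trans h1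
  have hc₄ : ¬ (q : ℤ) ∣ (⟨a1, a2, a3, a4, a6⟩ : WeierstrassCurve ℤ).c₄ := by rw [intCurve_c₄]; exact hc4
  refine hasSplitMultiplicativeReductionAtPrime_of_intModel_of_root hI q hΔ hc₄ ?_
  by_cases h2 : q = 2
  · subst h2
    simp only [splitAt, ↓reduceIte, decide_eq_true_eq] at hs
    have h1 : (a1 : ZMod 2) = 1 := intCast_zmod_two_eq_one_of_mod_ne hs.1
    have h23 : (a2 : ZMod 2) + (a3 : ZMod 2) = 0 := by
      have : ((a2 + a3 : ℤ) : ZMod 2) = 0 := by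
        rw [← ZMod.intCast_mod (a2 + a3) 2, show ((a2 + a3) % ((2 : ℕ) : ℤ)) = 0 from hs.2]; rfl
      push_cast at this; exact this
    exact nodal_two_root (⟨a1, a2, a3, a4, a6⟩ : WeierstrassCurve ℤ) h1 h23
  · simp only [splitAt, h2, ↓reduceIte] at hs
    have hJ := jacobiSym_eq_one_of_isQR hq h2 (by omega) hs
    have hsq : IsSquare (-(((⟨a1, a2, a3, a4, a6⟩ : WeierstrassCurve ℤ).c₆ : ℤ) : ZMod q)) := by
      rw [intCurve_c₆, ← Int.cast_neg]
      exact ZMod.isSquare_of_jacobiSym_eq_one hJ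
    exact nodal_root_of_isSquare ⟨a1, a2, a3, a4, a6⟩ q h2 hΔ hc₄ hsq

/-- **`HasErratumPrime W p` for a certified record with the Err certificate** (kernel theorem, no claim): the listed
non-split `q` with `p ∤ v_q(Δ) = ord_q(Δ_min)` is an erratum prime. [cite: SilvermanAEC2009, VII.5 Prop. 5.1(b)] -/
theorem hasErratumPrime_of_check (hc : r.check = true) [r.curve.IsElliptic] [r.curve.IsGloballyMinimal]
    (he : r.errAt = true) : HasErratumPrime r.curve r.p := by
  obtain ⟨⟨q, v⟩, ht, hcert⟩ := List.any_eq_true.mp he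
  simp only [Bool.and_eq_true, decide_eq_true_eq] at hcert
  obtain ⟨hmult, hval⟩ := r.mult_and_val_of_mem_bad hc ht
  have hns := r.not_split_of_mem_bad hc ht hcert.1
  exact ⟨q, _, hmult, hns, by rw [hval]; exact hcert.2⟩

/-- **`¬ HasErratumPrime W p` for a certified record with the Rest certificate** (kernel theorem, no claim): an erratum
prime would be a bad prime, hence listed (`mem_badPrimes_of_not_good`), but every listed prime is split or has
`p ∣ ord_q(Δ_min)`. [cite: SilvermanAEC2009, VII.5 Prop. 5.1(a) and (b)] -/
theorem not_hasErratumPrime_of_check (hc : r.check = true) [r.curve.IsElliptic] [r.curve.IsGloballyMinimal]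
    (hrest : r.restAt = true) : ¬ HasErratumPrime r.curve r.p := by
  rintro ⟨q, hq, hmult, hns, hndvd⟩
  have hbad : ¬ r.curve.HasGoodReductionAtPrime q :=
    fun hgood => WeierstrassCurve.HasMultiplicativeReduction.not_hasGoodReduction (R := ℤ_[q]) hmult hgood
  have hmem := r.mem_badPrimes_of_not_good hc hq.out hbad
  obtain ⟨⟨q', v⟩, ht, htq⟩ := r.exists_mem_bad_of_mem_badPrimes hmem
  have hqq : q' = q := htq
  subst hqq
  have hcert := List.all_eq_true.mp hrest (q', v) ht
  simp only [Bool.or_eq_true, decide_eq_true_eq] at hcert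
  rcases hcert with hs | hdvd
  · exact hns (r.split_of_mem_bad hc ht hs)
  · exact hndvd ((r.mult_and_val_of_mem_bad hc ht).2 ▸ hdvd)

end Record

end Summit.BirchSwinnertonDyer.Rank1Residual.X6.PrintCert
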